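import Summits.BirchSwinnertonDyer.Rank1Residual.X12.NoPrimeTorsion
import HarnessLib

/-!
# No rational `p`-torsion anywhere in the `ℚ`-isogeny class, II: the THEOREM for CM curves
# (`p` odd unramified in the CM field, or any `p ≥ 5`)

HONEST FRAMING (cell `b2b-bsdres`, run/shared/lean/b2b/bsd-rank1-residual/, verbatim in every
file): the goal of the cell is to DELETE the COMBINATION-SHAPED residual classes of the
Birch–Swinnerton-Dyer formula for ALL analytic-rank `≤ 1` elliptic curves over `ℚ` — "full BSD
formula for every rank `≤ 1` curve in class `C`" assembled STRICTLY from published theorems — so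
that the rank-`≤ 1` remainder becomes exactly the CONSTRUCTION-SHAPED classes, which are TYPED
(missing-input `Prop`s), NOT attempted. This is not "finishing BSD". Harvest seat 1 (census /
instrument seat for class X12; prover owner x1b since 2026-08-20T04:23Z), generation 17. Theorems
only; no definition, no named fact; nothing booked; no label and no census number moves; X12
REMAINS CONSTRUCTION-SHAPED. Sequel of `X12/NoPrimeTorsion.lean` (§1 the one-prime point-count
certificate, §2 the irreducible case); here the `htors` binder of T-LW (Lawson–Wuthrich 2016
Thm. 14: "no curve `ℚ`-isogenous to `E` has a rational point of order `p`") becomes a THEOREM on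
every CM pair at `p ≥ 5` — in particular on the fifteen `p`-RAMIFIED class-X12 pairs of the census
(`7 × (j = −3375, p = 7)`, `4 × (−32768, 11)`, `2 × (−884736, 19)`, `(−884736000, 43)`,
`(−147197952000, 67)`), whose only per-pair lever is T-LW.

* §3 `jacobiSym_neg_eq_neg_one_of_mod_eq` / `legendreSym_neg_eq_neg_one_of_mod_eq` — for primes
  `p ≡ 3 (mod 4)`, `p ≠ 3`, and a prime `ℓ ≡ −9 (mod 4p)`: `(−p/ℓ) = −1` (Jacobi reciprocity:
  `(−p/ℓ) = χ₄(ℓ)(p/ℓ) = (ℓ/p) = (−9/p) = χ₄(p) = −1`); `exists_prime_gt_mod_four_mul_eq` —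
  Dirichlet (`Nat.forall_exists_prime_gt_and_eq_mod`) supplies such `ℓ` beyond any bound. For a CM
  field with `d_K = −p` these are INERT primes with `p ∤ ℓ + 1`.
* §4 `eq_of_dvd_cmFieldDiscrOfJ` — a prime `p ≥ 5` dividing `d_K` of a CM curve over `ℚ` is one of
  `7, 11, 19, 43, 67, 163` and `d_K = −p`; `noPTorsion_isogenyClass_of_hasCM_of_cmRamified` — **CM,
  `p ≥ 5` ramified ⟹ `htors`**: pass to a globally minimal `ℚ`-isogenous `W₁` with CM by `𝒪_K`
  (gen 15 `exists_isGloballyMinimal_isIsogenous_maximal_cmFieldDiscr_eq`), take `ℓ ≡ −9 (mod 4p)`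
  prime beyond `max(|Δ_min(W₁)|, 4p)` (§3): `ℓ` is good and inert, so `a_ℓ(W₁) = 0` (Deuring, gen 15
  `frobeniusTrace_eq_zero_of_legendreSym_cmFieldDiscr_eq_neg_one`), `#Ẽ₁(𝔽_ℓ) = ℓ + 1 ≡ −8 (mod p)`
  is prime to `p`, and part I §1 applies to the class of `W₁`, which is the class of `W`;
  `noPTorsion_isogenyClass_of_not_cmRamified` — odd `p` unramified: `E[p]` irreducible (gen 15) and
  part I §2; **`noPTorsion_isogenyClass_of_hasCM` — CM ∧ `p ≥ 5` ⟹ `htors`**;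
  `eq_zero_of_nsmul_eq_zero_of_hasCM` — a CM curve over `ℚ` has no rational point `Q ≠ O` with
  `p • Q = O`, `p ≥ 5` (classically Olson 1974; proved here from Deuring + Dirichlet + *AEC* VII.3.1).
* §5 cell forms: `ClassX12 ∧ p ≥ 5 ⟹ htors` (`noPTorsion_isogenyClass_of_classX12`), and
  `j_ne_j121c2_of_hasCM` (no CM `j` is `−24729001 = j(121c2)`: Lawson–Wuthrich Thm. 1's item at
  `p = 11` never concerns a CM curve).

References: Lang, *Elliptic Functions* 13 §4 Thm. 12 (Deuring); Silverman *AEC* VII.3.1(b),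
VII.7.2, VIII.8.3; Silverman *Advanced Topics* II Ex. 2.12(b), App. A §3; Lawson–Wuthrich 2016
Thm. 1, Lemma 12, Thm. 14; Mazur 1978 Prop. 6.3.
-/

noncomputable section

open scoped Classical NumberTheorySymbols

open WeierstrassCurve Literature.NumberTheory.EllipticCurves
  Literature.NumberTheory.EllipticCurves.Rank1Residual

namespace Summit.BirchSwinnertonDyer.Rank1Residual.X12


/-! ## §3 Inert primes `ℓ ≢ −1 (mod p)` for the field `ℚ(√−p)`: `(−p/ℓ) = −1` for `ℓ ≡ −9 (mod 4p)` -/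

/-- **`(−p/ℓ) = −1` for primes `p ≡ 3 (mod 4)`, `p ≠ 3`, and odd `ℓ ≡ −9 (mod 4p)`** (Jacobi
symbols). `ℓ ≡ 3 (mod 4)`, so `(−p/ℓ) = χ₄(ℓ)·(p/ℓ) = (−1)·(−(ℓ/p))` (reciprocity, both entries
`≡ 3 (mod 4)`) `= (ℓ/p) = (−9/p) = χ₄(p)·(3²/p) = −1`. [folklore] -/
theorem jacobiSym_neg_eq_neg_one_of_mod_eq {p : ℕ} (hp : p.Prime) (hp4 : p % 4 = 3) (hp3 : p ≠ 3)
    {ℓ : ℕ} (hℓ : ℓ % (4 * p) = 4 * p - 9) : J(-(p : ℤ) | ℓ) = -1 := by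
  have hp7 : 7 ≤ p := by
    have := hp.two_le
    omega
  -- `ℓ ≡ 3 (mod 4)` and `ℓ ≡ −9 (mod p)`
  have hℓ4 : ℓ % 4 = 3 := by
    have h := Nat.mod_mod_of_dvd ℓ (dvd_mul_right 4 p)
    rw [hℓ] at h
    omega
  have hℓodd : Odd ℓ := Nat.odd_iff.mpr (by omega)
  have hpodd : Odd p := Nat.odd_iff.mpr (by omega)
  have hℓp : (ℓ : ℤ) % (p : ℤ) = (-9 : ℤ) % (p : ℤ) := by
    obtain ⟨k, hk⟩ : ∃ k : ℕ, ℓ = 4 * p * k + (4 * p - 9) := ⟨ℓ / (4 * p), by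
      have h := Nat.div_add_mod ℓ (4 * p)
      rw [hℓ] at h
      omega⟩
    zify [show 9 ≤ 4 * p by omega] at hk
    have : (ℓ : ℤ) = -9 + (p : ℤ) * (4 * (k : ℤ) + 4) := by rw [hk]; ring
    rw [this, Int.add_mul_emod_self_left]
  -- `(−p/ℓ) = χ₄ ℓ · (p/ℓ) = −(p/ℓ)`
  rw [jacobiSym.neg _ hℓodd, ZMod.χ₄_nat_three_mod_four hℓ4]
  -- reciprocity: `(p/ℓ) = −(ℓ/p)`
  rw [jacobiSym.quadratic_reciprocity_three_mod_four hp4 hℓ4]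
  -- `(ℓ/p) = (−9/p) = χ₄ p · (3²/p) = −1`
  rw [jacobiSym.mod_left' hℓp, show (-9 : ℤ) = -(3 ^ 2) by norm_num, jacobiSym.neg _ hpodd,
    ZMod.χ₄_nat_three_mod_four hp4]
  have hg : Int.gcd 3 (p : ℤ) = 1 := by
    rw [Int.gcd_eq_natAbs]
    change Nat.gcd 3 p = 1
    exact (Nat.coprime_primes Nat.prime_three hp).mpr hp3.symm
  rw [jacobiSym.sq_one' hg]
  norm_num

/-- Legendre form: for a prime `ℓ ≡ −9 (mod 4p)` (`p ≡ 3 (mod 4)` prime, `p ≠ 3`), `(−p/ℓ) = −1`,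
i.e. `ℓ` is INERT in `ℚ(√−p)`. [folklore] -/
theorem legendreSym_neg_eq_neg_one_of_mod_eq {p : ℕ} (hp : p.Prime) (hp4 : p % 4 = 3) (hp3 : p ≠ 3)
    {ℓ : ℕ} [Fact ℓ.Prime] (hℓ : ℓ % (4 * p) = 4 * p - 9) : legendreSym ℓ (-(p : ℤ)) = -1 := by
  rw [jacobiSym.legendreSym.to_jacobiSym]
  exact jacobiSym_neg_eq_neg_one_of_mod_eq hp hp4 hp3 hℓ

/-- **Dirichlet: primes `ℓ ≡ −9 (mod 4p)` beyond any bound** (`p ≠ 2, 3` prime, so that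
`gcd(4p − 9, 4p) = 1`; Mathlib `Nat.forall_exists_prime_gt_and_eq_mod`). [folklore] -/
theorem exists_prime_gt_mod_four_mul_eq {p : ℕ} (hp : p.Prime) (hp2 : p ≠ 2) (hp3 : p ≠ 3) (n : ℕ) :
    ∃ ℓ : ℕ, n < ℓ ∧ ℓ.Prime ∧ ℓ % (4 * p) = 4 * p - 9 := by
  have hp5 : 5 ≤ p := by
    by_contra h
    have h2 := hp.two_le
    interval_cases p
    · exact hp2 rfl
    · exact hp3 rfl
    · exact absurd hp (by decide)
  haveI : NeZero (4 * p) := ⟨by omega⟩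
  have hcop : (4 * p - 9).Coprime (4 * p) := by
    -- `4p − 9` is odd, and prime to `p` (else `p ∣ 9`, `p = 3`)
    have h2 : ¬ 2 ∣ 4 * p - 9 := by omega
    have hc4 : (4 * p - 9).Coprime 4 := by
      rw [show (4 : ℕ) = 2 ^ 2 by norm_num]
      exact (Nat.coprime_comm.mp ((Nat.Prime.coprime_iff_not_dvd Nat.prime_two).mpr h2)).pow_right 2
    have hnp : ¬ p ∣ 4 * p - 9 := by
      intro h
      have h9 : p ∣ 9 := by
        have h4p : p ∣ 4 * p := dvd_mul_left p 4
        have := Nat.dvd_sub h4p h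
        rwa [show 4 * p - (4 * p - 9) = 9 by omega] at this
      have h3 : p ∣ 3 := Nat.Prime.dvd_of_dvd_pow hp (show p ∣ 3 ^ 2 by simpa using h9)
      exact hp3 ((Nat.prime_dvd_prime_iff_eq hp Nat.prime_three).mp h3)
    have hcp : (4 * p - 9).Coprime p :=
      Nat.coprime_comm.mp ((Nat.Prime.coprime_iff_not_dvd hp).mpr hnp)
    exact Nat.Coprime.mul_right hc4 hcp
  obtain ⟨ℓ, hℓn, hℓ, hℓk⟩ :=
    Nat.forall_exists_prime_gt_and_eq_mod ((ZMod.isUnit_iff_coprime (4 * p - 9) (4 * p)).mpr hcop) n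
  refine ⟨ℓ, hℓn, hℓ, ?_⟩
  have hmod : ℓ ≡ 4 * p - 9 [MOD 4 * p] := (ZMod.natCast_eq_natCast_iff ℓ (4 * p - 9) (4 * p)).mp hℓk
  rw [Nat.ModEq] at hmod
  rw [hmod]
  exact Nat.mod_eq_of_lt (by omega)

/-! ## §4 CM curves: the table value `d_K = −p` at a ramified `p ≥ 5`, and the theorem -/

/-- For a CM curve and a prime `p ≥ 5` dividing `d_K = cmFieldDiscrOfJ j(W)`: `p ∈ {7, 11, 19,
43, 67, 163}` and `d_K = −p` (the table `−3, −4, −7, −8, −11, −19, −43, −67, −163`; `p ≥ 5` rules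
out `−3, −4, −8`). [cite: SilvermanATAEC1994, App. A §3 (table of CM j-invariants)] -/
theorem eq_of_dvd_cmFieldDiscrOfJ (W : WeierstrassCurve ℚ) [W.IsElliptic] (hCM : W.HasCM)
    {p : ℕ} (hp : p.Prime) (hp5 : 5 ≤ p) (hd : (p : ℤ) ∣ cmFieldDiscrOfJ W.j) :
    (p = 7 ∨ p = 11 ∨ p = 19 ∨ p = 43 ∨ p = 67 ∨ p = 163) ∧ cmFieldDiscrOfJ W.j = -(p : ℤ) := by
  have hj : W.j ∈ cmJInvariants := (hasCM_iff_j_mem_holds W).mp hCM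
  -- the nine values of the table
  have hvals : cmFieldDiscrOfJ W.j = -3 ∨ cmFieldDiscrOfJ W.j = -4 ∨ cmFieldDiscrOfJ W.j = -7 ∨
      cmFieldDiscrOfJ W.j = -8 ∨ cmFieldDiscrOfJ W.j = -11 ∨ cmFieldDiscrOfJ W.j = -19 ∨
      cmFieldDiscrOfJ W.j = -43 ∨ cmFieldDiscrOfJ W.j = -67 ∨ cmFieldDiscrOfJ W.j = -163 := by
    simp only [cmJInvariants, Finset.mem_insert, Finset.mem_singleton] at hj
    rcases hj with h | h | h | h | h | h | h | h | h | h | h | h | h <;>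
      rw [h] <;> norm_num [cmFieldDiscrOfJ]
  -- `p ∣ |d_K|` in `ℕ`
  have hdn : p ∣ (cmFieldDiscrOfJ W.j).natAbs := Int.natCast_dvd.mp hd
  have hsmall : ∀ m : ℕ, m < 5 → 0 < m → ¬ p ∣ m := fun m hm hm0 h ↦ by
    have := Nat.le_of_dvd hm0 h
    omega
  have h8 : ¬ p ∣ 8 := fun h ↦ hsmall 2 (by norm_num) (by norm_num)
    (Nat.Prime.dvd_of_dvd_pow hp (show p ∣ 2 ^ 3 by simpa using h))
  have hprime : ∀ q : ℕ, q.Prime → p ∣ q → p = q := fun q hq h ↦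
    (Nat.prime_dvd_prime_iff_eq hp hq).mp h
  rcases hvals with hv | hv | hv | hv | hv | hv | hv | hv | hv <;> rw [hv] at hdn ⊢ <;>
    norm_num at hdn
  · exact absurd hdn (hsmall 3 (by norm_num) (by norm_num))
  · exact absurd hdn (hsmall 4 (by norm_num) (by norm_num))
  · obtain rfl := hprime 7 (by norm_num) hdn; norm_num
  · exact absurd hdn h8
  · obtain rfl := hprime 11 (by norm_num) hdn; norm_num
  · obtain rfl := hprime 19 (by norm_num) hdn; norm_num
  · obtain rfl := hprime 43 (by norm_num) hdn; norm_num
  · obtain rfl := hprime 67 (by norm_num) hdn; norm_num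
  · obtain rfl := hprime 163 (by norm_num) hdn; norm_num

/-- At a ramified `p ≥ 5` of a CM curve over `ℚ`: `d_K = −p`.
[cite: SilvermanATAEC1994, App. A §3 (table of CM j-invariants)] -/
theorem cmFieldDiscrOfJ_eq_neg_of_dvd (W : WeierstrassCurve ℚ) [W.IsElliptic] (hCM : W.HasCM)
    {p : ℕ} (hp : p.Prime) (hp5 : 5 ≤ p) (hd : (p : ℤ) ∣ cmFieldDiscrOfJ W.j) :
    cmFieldDiscrOfJ W.j = -(p : ℤ) :=
  (eq_of_dvd_cmFieldDiscrOfJ W hCM hp hp5 hd).2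

/-- At a ramified `p ≥ 5` of a CM curve over `ℚ`: `p ≡ 3 (mod 4)` (and `p ≠ 3`).
[cite: SilvermanATAEC1994, App. A §3 (table of CM j-invariants)] -/
theorem mod_four_eq_three_of_dvd_cmFieldDiscrOfJ (W : WeierstrassCurve ℚ) [W.IsElliptic]
    (hCM : W.HasCM) {p : ℕ} (hp : p.Prime) (hp5 : 5 ≤ p) (hd : (p : ℤ) ∣ cmFieldDiscrOfJ W.j) :
    p % 4 = 3 := by
  rcases (eq_of_dvd_cmFieldDiscrOfJ W hCM hp hp5 hd).1 with h | h | h | h | h | h <;> omega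

/-- **CM, `p ≥ 5` RAMIFIED in the CM field ⟹ no curve `ℚ`-isogenous to `E` has a rational point of
order `p`.** Then `d_K = −p` (`p ∈ {7, 11, 19, 43, 67, 163}`). Let `W₁ ~ W` be globally minimal
with `j(W₁) ∈ maximalCMJInvariants` and `cmFieldDiscr j(W₁) = d_K` (gen 15, Silverman *AT* II
Ex. 2.12(b)), and `ℓ ≡ −9 (mod 4p)` a prime `> |Δ_min(W₁)|` (Dirichlet): `ℓ ∤ 2 d_K`, `ℓ` is good
for `W₁`, `(d_K/ℓ) = −1` (§3), so `a_ℓ(W₁) = 0` (Deuring; gen 15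
`frobeniusTrace_eq_zero_of_legendreSym_cmFieldDiscr_eq_neg_one`) and `#Ẽ₁(𝔽_ℓ) = ℓ + 1 ≡ −8 (mod p)`
is prime to `p`; §1 on the class of `W₁`, which is the class of `W`.
[cite: Lang1987, Ch. 13 §4 Thm. 12 (PDF p. 140)] [cite: SilvermanAEC2009, VII.3.1(b) and Cor. VII.7.2]
[cite: SilvermanAdvancedTopics1994, Exercise 2.12(b) and App. A §3 (p. 483)] -/
theorem noPTorsion_isogenyClass_of_hasCM_of_cmRamified (W : WeierstrassCurve ℚ) [W.IsElliptic]
    (hCM : W.HasCM) {p : ℕ} [hp : Fact p.Prime] (hp5 : 5 ≤ p) (hram : CMRamified W p) :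
    ∀ (W' : WeierstrassCurve ℚ) [W'.IsElliptic], IsIsogenous W W' →
      ∀ Q : W'.toAffine.Point, p • Q = 0 → Q = 0 := by
  have hpP : p.Prime := hp.out
  have hdK : cmFieldDiscrOfJ W.j = -(p : ℤ) := cmFieldDiscrOfJ_eq_neg_of_dvd W hCM hpP hp5 hram
  have hp4 : p % 4 = 3 := mod_four_eq_three_of_dvd_cmFieldDiscrOfJ W hCM hpP hp5 hram
  have hp3 : p ≠ 3 := by omega
  have hp2 : p ≠ 2 := by omega
  have hj : W.j ∈ cmJInvariants := (hasCM_iff_j_mem_holds W).mp hCM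
  -- a globally minimal maximal-order model in the isogeny class, same CM field
  obtain ⟨W₁, hE₁, hmin₁, hiso₁, hj₁, hd₁⟩ :=
    exists_isGloballyMinimal_isIsogenous_maximal_cmFieldDiscr_eq W hj
  haveI := hE₁
  haveI := hmin₁
  rw [hdK] at hd₁
  -- a large prime `ℓ ≡ −9 (mod 4p)`
  obtain ⟨ℓ, hℓn, hℓP, hℓmod⟩ :=
    exists_prime_gt_mod_four_mul_eq hpP hp2 hp3 (max (minimalDiscriminantInt W₁).natAbs (4 * p))
  haveI : Fact ℓ.Prime := ⟨hℓP⟩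
  have hℓ4 : ℓ % 4 = 3 := by
    have h := Nat.mod_mod_of_dvd ℓ (dvd_mul_right 4 p)
    rw [hℓmod] at h
    omega
  have hℓ3 : 3 ≤ ℓ := by omega
  have hℓΔ : ¬ (ℓ : ℤ) ∣ minimalDiscriminantInt W₁ :=
    natCast_not_dvd_of_natAbs_lt (W₁.minimalDiscriminantInt_ne_zero)
      (lt_of_le_of_lt (le_max_left _ _) hℓn)
  have hgood₁ : W₁.HasGoodReductionAtPrime ℓ := hasGoodReductionAtPrime_of_not_dvd W₁ ℓ hℓΔ
  -- `ℓ ∤ 2 d_K = −2p`: `ℓ` is odd and `ℓ ≡ −9 (mod p)` with `ℓ > 4p > 9`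
  have hℓd : ¬ (ℓ : ℤ) ∣ 2 * cmFieldDiscr W₁.j := by
    rw [hd₁]
    intro h
    have hℓZ : Prime (ℓ : ℤ) := Nat.prime_iff_prime_int.mp hℓP
    have h' : (ℓ : ℤ) ∣ 2 * (p : ℤ) := by
      have := dvd_neg.mpr h
      simpa using this
    rcases hℓZ.dvd_or_dvd h' with h2 | hdp
    · have : ℓ ∣ 2 := by exact_mod_cast h2
      have := (Nat.prime_dvd_prime_iff_eq hℓP Nat.prime_two).mp this
      omega
    · have hℓp' : ℓ ∣ p := by exact_mod_cast hdp
      have heq : ℓ = p := (Nat.prime_dvd_prime_iff_eq hℓP hpP).mp hℓp'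
      have hlt : 4 * p < ℓ := lt_of_le_of_lt (le_max_right _ _) hℓn
      omega
  -- Deuring: `a_ℓ(W₁) = 0`
  have hinert : legendreSym ℓ (cmFieldDiscr W₁.j) = -1 := by
    rw [hd₁]
    exact legendreSym_neg_eq_neg_one_of_mod_eq hpP hp4 hp3 hℓmod
  have htr : W₁.frobeniusTrace ℓ = 0 :=
    frobeniusTrace_eq_zero_of_legendreSym_cmFieldDiscr_eq_neg_one W₁ hj₁ ℓ hℓd hℓΔ hinert
  -- `p ∤ #Ẽ₁(𝔽_ℓ) = ℓ + 1 ≡ −8 (mod p)`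
  have hN : ¬ (p : ℤ) ∣ (ℓ : ℤ) + 1 - W₁.frobeniusTrace ℓ := by
    rw [htr, sub_zero]
    intro h
    have h9 : (p : ℤ) ∣ (ℓ : ℤ) + 9 := by
      obtain ⟨k, hk⟩ : ∃ k : ℕ, ℓ = 4 * p * k + (4 * p - 9) := ⟨ℓ / (4 * p), by
        have hdm := Nat.div_add_mod ℓ (4 * p)
        rw [hℓmod] at hdm
        omega⟩
      zify [show 9 ≤ 4 * p by omega] at hk
      have : (ℓ : ℤ) + 9 = (p : ℤ) * (4 * (k : ℤ) + 4) := by rw [hk]; ring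
      rw [this]
      exact dvd_mul_right _ _
    have h8 : (p : ℤ) ∣ 8 := by
      have := dvd_sub h9 h
      simpa using this
    have h8' : p ∣ 8 := by exact_mod_cast h8
    have h2' : p ∣ 2 := Nat.Prime.dvd_of_dvd_pow hpP (show p ∣ 2 ^ 3 by simpa using h8')
    have := Nat.le_of_dvd (by norm_num) h2'
    omega
  -- §1 on the class of `W₁ ~ W ~ W'`
  intro W' _ hiso Q hQ
  have hiso' : IsIsogenous W₁ W' := hiso₁.symm_of_charZero.trans' hiso
  exact noPTorsion_isogenyClass_of_not_dvd_frobenius W₁ hℓ3 hgood₁ hN W' hiso' Q hQ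

/-- **THEOREM (CM, odd `p` UNRAMIFIED in the CM field) ⟹ no curve `ℚ`-isogenous to `E` has a
rational point of order `p`** — `E[p]` is irreducible (gen 15
`hasIrreducibleModPGaloisRep_of_not_dvd_cmFieldDiscrOfJ`) and §2; `p = 3` allowed when `3 ∤ d_K`.
(The hypothesis `¬ CMRamified W p` already forces `W` to be CM.) [cite: Mazur1978, §6 Prop. 6.3 (1) (p. 153)]
[cite: Lang1987, Ch. 13 §4 Thm. 12 (PDF p. 140)] -/
theorem noPTorsion_isogenyClass_of_not_cmRamified (W : WeierstrassCurve ℚ) [W.IsElliptic]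
    {p : ℕ} [Fact p.Prime] (hp2 : p ≠ 2) (hnr : ¬ CMRamified W p) :
    ∀ (W' : WeierstrassCurve ℚ) [W'.IsElliptic], IsIsogenous W W' →
      ∀ Q : W'.toAffine.Point, p • Q = 0 → Q = 0 :=
  noPTorsion_isogenyClass_of_irr W (hasIrreducibleModPGaloisRep_of_not_dvd_cmFieldDiscrOfJ W p hp2 hnr)

/-- **THEOREM: a CM elliptic curve over `ℚ` and a prime `p ≥ 5` — no curve `ℚ`-isogenous to it has
a rational point of order `p`** (either splitting type: unramified by irreducibility, ramified by the
inert point-count certificate). Any Weierstrass model. (Classically a consequence of Olson 1974 /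
the list of torsion groups of CM curves over `ℚ`; proved here from Deuring + Dirichlet + *AEC*
VII.3.1.) [cite: Lang1987, Ch. 13 §4 Thm. 12 (PDF p. 140)] [cite: SilvermanAEC2009, VII.3.1(b) and Cor. VII.7.2]
[cite: Mazur1978, §6 Prop. 6.3 (1) (p. 153)] -/
theorem noPTorsion_isogenyClass_of_hasCM (W : WeierstrassCurve ℚ) [W.IsElliptic] (hCM : W.HasCM)
    {p : ℕ} [Fact p.Prime] (hp5 : 5 ≤ p) :
    ∀ (W' : WeierstrassCurve ℚ) [W'.IsElliptic], IsIsogenous W W' →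
      ∀ Q : W'.toAffine.Point, p • Q = 0 → Q = 0 := by
  by_cases hram : CMRamified W p
  · exact noPTorsion_isogenyClass_of_hasCM_of_cmRamified W hCM hp5 hram
  · exact noPTorsion_isogenyClass_of_not_cmRamified W (by omega) hram

/-- In particular **a CM curve over `ℚ` has no rational point `Q ≠ O` with `p • Q = O`, `p ≥ 5`**.
[cite: Lang1987, Ch. 13 §4 Thm. 12 (PDF p. 140)] [cite: SilvermanAEC2009, VII.3.1(b)] -/
theorem eq_zero_of_nsmul_eq_zero_of_hasCM (W : WeierstrassCurve ℚ) [W.IsElliptic] (hCM : W.HasCM)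
    {p : ℕ} [Fact p.Prime] (hp5 : 5 ≤ p) (Q : W.toAffine.Point) (hQ : p • Q = 0) : Q = 0 :=
  noPTorsion_isogenyClass_of_hasCM W hCM hp5 W (isIsogenous_self W) Q hQ

/-! ## §5 Cell forms -/

section Cell

variable (W : WeierstrassCurve ℚ) [W.IsElliptic] (p : ℕ) [hp : Fact p.Prime]

/-- **Class X12 at `p ≥ 5`: the `htors` binder of T-LW holds as a THEOREM** (CM; both the 72-pair
inert-bad core and the 15 ramified pairs of the census). [cite: Lang1987, Ch. 13 §4 Thm. 12 (PDF p. 140)]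
[cite: SilvermanAEC2009, VII.3.1(b) and Cor. VII.7.2] -/
theorem noPTorsion_isogenyClass_of_classX12 (hX : ClassX12 W p) (hp5 : 5 ≤ p) :
    ∀ (W' : WeierstrassCurve ℚ) [W'.IsElliptic], IsIsogenous W W' →
      ∀ Q : W'.toAffine.Point, p • Q = 0 → Q = 0 :=
  noPTorsion_isogenyClass_of_hasCM W hX.1 hp5

omit hp in
/-- **No CM `j`-invariant is `−24729001 = j(121c2)`** (the curve of Lawson–Wuthrich Thm. 1, item
`p = 11`, is not CM: its `j = −11·131³` is none of the thirteen CM values). So item three of Theorem 1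
never concerns a CM curve. [cite: LawsonWuthrich2016, Thm. 1 (arXiv:1505.02940 p. 2) and Lemma 12 (p. 6)]
[cite: SilvermanATAEC1994, App. A §3 (table of CM j-invariants)] -/
theorem j_ne_j121c2_of_hasCM (hCM : W.HasCM) : W.j ≠ -24729001 := by
  have hj : W.j ∈ cmJInvariants := (hasCM_iff_j_mem_holds W).mp hCM
  intro h
  rw [h] at hj
  simp only [cmJInvariants, Finset.mem_insert, Finset.mem_singleton] at hj
  norm_num at hj

/-- Class-X12 form of the previous lemma. [cite: LawsonWuthrich2016, Thm. 1 (arXiv:1505.02940 p. 2)] -/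
theorem j_ne_j121c2_of_classX12 (hX : ClassX12 W p) : W.j ≠ -24729001 :=
  j_ne_j121c2_of_hasCM W hX.1

end Cell

end Summit.BirchSwinnertonDyer.Rank1Residual.X12

end
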